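import Mathlib
import Summits.NavierStokesRegularity.NavierStokesRegularity.Theorems.EulerZoomLiouvillePowerGaugeEulerLiouvilleBootstrapStep
import HarnessLib

/-!
# Scale-wise quasi-monotonicity of the energy (infinite-energy members included)
# (crux `EulerZoomLiouville.PowerGaugeEulerLiouville` = stmt-NavierStokesRegularity-19832, lead's line `birth`)

Route `EulerZoomLiouville` (NavierStokesRegularity).  The bootstrap in scale (`…BootstrapEnergy`) gives the global energy
inequality from every FINITE-energy start.  The natural in-window candidates (self-similar tails `|V| ~ |y|^{-(1+ρ)}`) have
INFINITE energy at every time for `ρ < 1/2` (`∫_{B_R}|u|² ~ R^{1−2ρ}`, saturating the `A`-gauge).  For them the first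
bootstrap step still says something: at every large scale the energy is QUASI-NON-INCREASING, with an error one sixth of
a power below the natural size `R^{1−2ρ}`:

* `scaleEnergy_quasi_antitone` — member (`0 ≤ ρ ≤ 1/2`), a start `s₀ < b ≤ 0` from which the sliced energy inequality
  holds against all cut-offs `φ_k = cutoff (k+1)` (a.e. `s₀`): there is `C'` with, for a.e. `t ∈ (s₀,b)` and all
  `k ≥ ⌈√(−s₀)⌉`, `∫ |u(t)|² φ_k ≤ ∫ |u(s₀)|² φ_k + C' (k+1)^{(1−2ρ) − 1/6}`.

(The `A`-gauge profile `c r^{1−2ρ}` feeds `exists_oneBall_window_le_of_sliceExponent`; the flux through the sphere of radius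
`R_k = k+1` over the window is `≲ R_k^{(1−2ρ)+5/6−1}`.)  For the normalised energies `R^{2ρ−1}∫_{B_R}|u(t)|²` (bounded by `c`)
this is monotonicity up to `O(R^{−1/6})`.  WHAT THIS IS NOT: not NS, not the open core; structure of the class,
`--supports` stmt-19832. [folklore]
-/

noncomputable section

set_option linter.dupNamespace false

open MeasureTheory Set Filter Topology Metric Function TopologicalSpace
open scoped ENNReal NNReal InnerProductSpace RealInnerProductSpace Laplacian

namespace Summit.NavierStokesRegularity.NavierStokesRegularity.Theorems.PowerGaugeEulerLiouville

open Literature.Analysis Literature.Analysis.FunctionSpaces Literature.Analysis.FluidPDE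

/-- **Scale-wise quasi-monotonicity of the energy.**  See the file docstring. [folklore] -/
theorem scaleEnergy_quasi_antitone {ρ : ℝ} (hρ : 0 ≤ ρ) (hρh : ρ ≤ 1 / 2)
    {u : ℝ → EuclideanSpace ℝ (Fin 3) → EuclideanSpace ℝ (Fin 3)} {p : ℝ → EuclideanSpace ℝ (Fin 3) → ℝ}
    {H : ℝ → EuclideanSpace ℝ (Fin 3) → EuclideanSpace ℝ (Fin 3) →L[ℝ] EuclideanSpace ℝ (Fin 3)} {c : ℝ≥0}
    (hsw : IsSuitableWeakSolutionOn (slab (EuclideanSpace ℝ (Fin 3)) (Iio 0) isOpen_Iio) 0 0 u p)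
    (hH : HasWeakSpatialGradientOn (slab (EuclideanSpace ℝ (Fin 3)) (Iio 0) isOpen_Iio) u H)
    (hc : ∀ a : ℝ, 0 < a → ENNReal.ofReal (a ^ (2 * ρ)) * cknA a (0 : ℝ × EuclideanSpace ℝ (Fin 3)) u +
        ENNReal.ofReal (a ^ ρ) * cknE a (0 : ℝ × EuclideanSpace ℝ (Fin 3)) H +
        ENNReal.ofReal (a ^ (2 * ρ)) * cknD a (0 : ℝ × EuclideanSpace ℝ (Fin 3)) p ≤ (c : ℝ≥0∞))
    {s₀ b : ℝ} (hs₀b : s₀ < b) (hb : b ≤ 0)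
    (hstart : ∀ k : ℕ, ∀ᵐ t ∂(volume.restrict (Ioo s₀ b)),
      ∫ x, ‖u t x‖ ^ 2 * cutoff (E := EuclideanSpace ℝ (Fin 3)) ((k : ℝ) + 1) x ≤
        (∫ x, ‖u s₀ x‖ ^ 2 * cutoff (E := EuclideanSpace ℝ (Fin 3)) ((k : ℝ) + 1) x) +
        ∫ z in Ico s₀ t ×ˢ (univ : Set (EuclideanSpace ℝ (Fin 3))),
          (‖u z.1 z.2‖ ^ 2 * (0 * (Δ (cutoff (E := EuclideanSpace ℝ (Fin 3)) ((k : ℝ) + 1))) z.2) +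
            (‖u z.1 z.2‖ ^ 2 + 2 * p z.1 z.2) *
              ⟪u z.1 z.2, gradient (cutoff (E := EuclideanSpace ℝ (Fin 3)) ((k : ℝ) + 1)) z.2⟫))
 :
    ∃ C' : ℝ, ∀ᵐ t ∂(volume.restrict (Ioo s₀ b)), ∀ k : ℕ, ⌈Real.sqrt (-s₀)⌉₊ ≤ k →
      ∫ x, ‖u t x‖ ^ 2 * cutoff (E := EuclideanSpace ℝ (Fin 3)) ((k : ℝ) + 1) x ≤
        (∫ x, ‖u s₀ x‖ ^ 2 * cutoff (E := EuclideanSpace ℝ (Fin 3)) ((k : ℝ) + 1) x) +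
          C' * ((k : ℝ) + 1) ^ ((1 - 2 * ρ) - 1 / 6) := by
  obtain ⟨C, hC0, hcut⟩ := cutoffFacts
  have hs₀ : s₀ < 0 := lt_of_lt_of_le hs₀b hb
  set W : Set ℝ := Ioo s₀ b with hW
  -- the `A`-gauge slice profile, exponent `s = 1 − 2ρ ∈ [0, 1]`
  set s : ℝ := 1 - 2 * ρ with hsdef
  have hs0 : 0 ≤ s := by rw [hsdef]; linarith
  have hs1 : s ≤ 1 := by rw [hsdef]; linarith
  have hAg := hasScaledLocalEnergyBound_of_gaugeA (ρ := ρ)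
    (fun a ha => le_trans (le_trans le_self_add le_self_add) (hc a ha))
  set Lc : ℝ := Real.sqrt (-s₀) + 1 with hLc
  have hLc1 : 1 ≤ Lc := by rw [hLc]; linarith [Real.sqrt_nonneg (-s₀)]
  have hLc0 : 0 < Lc := lt_of_lt_of_le one_pos hLc1
  have hA : ∀ᵐ t ∂(volume.restrict (Ioo s₀ b)), ∀ r : ℝ, 1 ≤ r →
      ∫⁻ x in ball (0 : EuclideanSpace ℝ (Fin 3)) r, ‖u t x‖ₑ ^ 2 ≤
        ENNReal.ofReal (((⟨(c : ℝ) * Lc ^ s, by positivity⟩ : ℝ≥0) : ℝ) * r ^ s) := by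
    rw [ae_restrict_iff' measurableSet_Ioo]
    refine Eventually.of_forall fun t ht r hr => ?_
    have hr0 : 0 < r := lt_of_lt_of_le one_pos hr
    set r' : ℝ := r * Lc with hr'
    have hr'0 : 0 < r' := by positivity
    have hrr' : r ≤ r' := by rw [hr']; nlinarith
    have htQ : t ∈ Ioo (-(r' ^ 2)) 0 := by
      refine ⟨?_, lt_of_lt_of_le ht.2 hb⟩
      have h1 : Real.sqrt (-s₀) ^ 2 = -s₀ := Real.sq_sqrt (by linarith)
      have h2 : Real.sqrt (-s₀) ≤ r' := by rw [hr', hLc]; nlinarith [Real.sqrt_nonneg (-s₀)]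
      nlinarith [ht.1, Real.sqrt_nonneg (-s₀)]
    refine ((lintegral_mono_set (ball_subset_ball hrr')).trans (hAg r' hr'0 t htQ)).trans (ENNReal.ofReal_le_ofReal ?_)
    change (c : ℝ) * r' ^ (1 - 2 * ρ) ≤ (c : ℝ) * Lc ^ s * r ^ s
    rw [← hsdef, hr', Real.mul_rpow hr0.le hLc0.le]
    nlinarith [c.2, Real.rpow_nonneg hr0.le s, Real.rpow_nonneg hLc0.le s]
  obtain ⟨M, hM0, hM⟩ := exists_oneBall_window_le_of_sliceExponent hρ hs0 hs1 hsw hH hc hs₀b hb hA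
  set σ : ℝ := s + 5 / 6 with hσ
  have hσ0 : 0 ≤ σ := by rw [hσ]; linarith
  have hσ2 : σ ≤ 2 := by rw [hσ]; linarith
  -- cut-offs
  set Rk : ℕ → ℝ := fun k => (k : ℝ) + 1 with hRk
  have hRk1 : ∀ k, 1 ≤ Rk k := fun k => by simp only [hRk]; linarith [(Nat.cast_nonneg k : (0 : ℝ) ≤ k)]
  have hRk0 : ∀ k, 0 < Rk k := fun k => lt_of_lt_of_le one_pos (hRk1 k)
  set φ : ℕ → EuclideanSpace ℝ (Fin 3) → ℝ := fun k => cutoff (Rk k) with hφdef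
  have hφ : ∀ k, ContDiff ℝ (⊤ : ℕ∞) (φ k) := fun k => (hcut (Rk k) (hRk0 k)).1
  have hφ0 : ∀ k x, 0 ≤ φ k x := fun k => (hcut (Rk k) (hRk0 k)).2.2.1
  have hφ1 : ∀ k x, φ k x ≤ 1 := fun k => (hcut (Rk k) (hRk0 k)).2.2.2.1
  have hφone : ∀ k, ∀ x ∈ ball (0 : EuclideanSpace ℝ (Fin 3)) (Rk k), φ k x = 1 :=
    fun k => (hcut (Rk k) (hRk0 k)).2.2.2.2.1
  have hφsupp : ∀ k x, φ k x ≠ 0 → x ∈ ball (0 : EuclideanSpace ℝ (Fin 3)) (2 * Rk k + 1) :=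
    fun k => (hcut (Rk k) (hRk0 k)).2.2.2.2.2.2.1
  have hφgrad : ∀ k (x v : EuclideanSpace ℝ (Fin 3)), |⟪v, gradient (φ k) x⟫| ≤ C / Rk k * ‖v‖ :=
    fun k => (hcut (Rk k) (hRk0 k)).2.2.2.2.2.2.2.1
  have hφout : ∀ k (x : EuclideanSpace ℝ (Fin 3)), 2 * Rk k < ‖x‖ → gradient (φ k) x = 0 :=
    fun k => (hcut (Rk k) (hRk0 k)).2.2.2.2.2.2.2.2
  -- the scales `a_k = 2R_k + 1` fit the window for `k ≥ k₀`
  set k₀ : ℕ := ⌈Real.sqrt (-s₀)⌉₊ with hk₀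
  set ak : ℕ → ℝ := fun k => 2 * Rk k + 1 with hak
  have hak1 : ∀ k, 1 ≤ ak k := fun k => by simp only [hak]; linarith [hRk1 k]
  have hak0 : ∀ k, 0 < ak k := fun k => lt_of_lt_of_le one_pos (hak1 k)
  have hakα : ∀ k, k₀ ≤ k → -(ak k ^ 2) ≤ s₀ := by
    intro k hk
    have h1 : Real.sqrt (-s₀) ≤ (k₀ : ℝ) := Nat.le_ceil _
    have h2 : (k₀ : ℝ) ≤ k := by exact_mod_cast hk
    have h3 : Real.sqrt (-s₀) ^ 2 = -s₀ := Real.sq_sqrt (by linarith)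
    have h4 : Real.sqrt (-s₀) ≤ ak k := by simp only [hak, hRk]; linarith [Real.sqrt_nonneg (-s₀)]
    nlinarith [Real.sqrt_nonneg (-s₀)]
  -- the one-ball masses
  set N : ℕ → ℝ≥0∞ := fun k => ∫⁻ z in W ×ˢ ball (0 : EuclideanSpace ℝ (Fin 3)) (ak k),
    (‖u z.1 z.2‖ₑ ^ (3 : ℕ) + 2 * (‖p z.1 z.2‖ₑ * ‖u z.1 z.2‖ₑ)) with hN
  have hNle : ∀ k, k₀ ≤ k → N k ≤ ENNReal.ofReal (M * ak k ^ σ) := fun k hk => hM (ak k) (hak1 k) (hakα k hk)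
  -- measurability on the slab
  have hum : AEStronglyMeasurable (uncurry u)
      (volume.restrict (Iio (0 : ℝ) ×ˢ (univ : Set (EuclideanSpace ℝ (Fin 3))))) := by
    have := hH.locallyIntegrableOn.aestronglyMeasurable
    simpa [slab] using this
  have hpm : AEStronglyMeasurable (uncurry p)
      (volume.restrict (Iio (0 : ℝ) ×ˢ (univ : Set (EuclideanSpace ℝ (Fin 3))))) := by
    have := hsw.distributional.2.2.1.aestronglyMeasurable
    simpa [slab] using this
  -- ## the flux bound: `∫_{[s₀,t)×ℝ³} F_k ≤ (C/R_k) M a_k^σ` for `k ≥ k₀`, `t ≤ b`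
  have hfluxle : ∀ (k : ℕ), k₀ ≤ k → ∀ t : ℝ, t ≤ b →
      ∫ z in Ico s₀ t ×ˢ (univ : Set (EuclideanSpace ℝ (Fin 3))),
        (‖u z.1 z.2‖ ^ 2 * (0 * Δ (φ k) z.2) + (‖u z.1 z.2‖ ^ 2 + 2 * p z.1 z.2) * ⟪u z.1 z.2, gradient (φ k) z.2⟫)
        ≤ C / Rk k * (M * ak k ^ σ) := by
    intro k hk t ht
    set S : Set (ℝ × EuclideanSpace ℝ (Fin 3)) := Ioo s₀ t ×ˢ (univ : Set (EuclideanSpace ℝ (Fin 3))) with hS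
    rw [setIntegral_congr_set (Ico_prod_univ_ae_eq_Ioo_prod_univ s₀ t)]
    have hSW : S ⊆ W ×ˢ (univ : Set (EuclideanSpace ℝ (Fin 3))) := prod_mono (Ioo_subset_Ioo le_rfl ht) Subset.rfl
    have hSs : S ⊆ Iio (0 : ℝ) ×ˢ (univ : Set (EuclideanSpace ℝ (Fin 3))) :=
      prod_mono (fun τ hτ => lt_of_lt_of_le hτ.2 (ht.trans hb)) Subset.rfl
    set F : ℝ × EuclideanSpace ℝ (Fin 3) → ℝ := fun z =>
      ‖u z.1 z.2‖ ^ 2 * (0 * Δ (φ k) z.2) + (‖u z.1 z.2‖ ^ 2 + 2 * p z.1 z.2) * ⟪u z.1 z.2, gradient (φ k) z.2⟫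
      with hF
    -- the majorant `B = (C/R_k) (|u|² + 2|p|) |u| 1_{B(0, a_k)}`
    set T : Set (ℝ × EuclideanSpace ℝ (Fin 3)) := {z | z.2 ∈ ball (0 : EuclideanSpace ℝ (Fin 3)) (ak k)} with hT
    have hTm : MeasurableSet T := measurableSet_ball.preimage measurable_snd
    set g : ℝ × EuclideanSpace ℝ (Fin 3) → ℝ := fun z => ‖u z.1 z.2‖ ^ 3 + 2 * |p z.1 z.2| * ‖u z.1 z.2‖ with hg
    have hg0 : ∀ z, 0 ≤ g z := fun z => by simp only [hg]; positivity
    set B : ℝ × EuclideanSpace ℝ (Fin 3) → ℝ := T.indicator (fun z => C / Rk k * g z) with hB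
    have hB0 : ∀ z, 0 ≤ B z := fun z => indicator_nonneg (fun w _ => mul_nonneg (by positivity) (hg0 w)) _
    have hFB : ∀ z, |F z| ≤ B z := by
      intro z
      have h0 : F z = (‖u z.1 z.2‖ ^ 2 + 2 * p z.1 z.2) * ⟪u z.1 z.2, gradient (φ k) z.2⟫ := by
        simp only [hF, zero_mul, mul_zero, zero_add]
      rw [h0]
      by_cases hz : z.2 ∈ ball (0 : EuclideanSpace ℝ (Fin 3)) (ak k)
      · rw [hB, indicator_of_mem (show z ∈ T from hz), abs_mul]
        calc |‖u z.1 z.2‖ ^ 2 + 2 * p z.1 z.2| * |⟪u z.1 z.2, gradient (φ k) z.2⟫|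
            ≤ (‖u z.1 z.2‖ ^ 2 + 2 * |p z.1 z.2|) * (C / Rk k * ‖u z.1 z.2‖) := by
              refine mul_le_mul ?_ (hφgrad k z.2 _) (abs_nonneg _) (by positivity)
              calc |‖u z.1 z.2‖ ^ 2 + 2 * p z.1 z.2| ≤ |‖u z.1 z.2‖ ^ 2| + |2 * p z.1 z.2| := abs_add_le _ _
                _ = ‖u z.1 z.2‖ ^ 2 + 2 * |p z.1 z.2| := by rw [abs_of_nonneg (sq_nonneg _), abs_mul, abs_two]
          _ = C / Rk k * g z := by simp only [hg]; ring
      · have hfar : 2 * Rk k < ‖z.2‖ := by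
          rw [mem_ball_zero_iff, not_lt] at hz
          simp only [hak] at hz; linarith
        rw [hφout k z.2 hfar, inner_zero_right, mul_zero, abs_zero]
        exact hB0 z
    -- integrability of the majorant on `S` from the finite one-ball mass
    have hsubT : S ∩ T ⊆ W ×ˢ ball (0 : EuclideanSpace ℝ (Fin 3)) (ak k) := by
      rintro z ⟨hzS, hzT⟩; exact ⟨(hSW hzS).1, hzT⟩
    have hptw : ∀ z : ℝ × EuclideanSpace ℝ (Fin 3),
        ENNReal.ofReal (g z) = ‖u z.1 z.2‖ₑ ^ (3 : ℕ) + 2 * (‖p z.1 z.2‖ₑ * ‖u z.1 z.2‖ₑ) := by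
      intro z
      simp only [hg]
      rw [ENNReal.ofReal_add (by positivity) (by positivity), ENNReal.ofReal_pow (norm_nonneg _), ofReal_norm,
        mul_assoc, ENNReal.ofReal_mul (by norm_num : (0:ℝ) ≤ 2), ENNReal.ofReal_ofNat,
        ENNReal.ofReal_mul (abs_nonneg _), ← Real.norm_eq_abs, ofReal_norm, ofReal_norm]
    have hNT : ∫⁻ z in S ∩ T, ENNReal.ofReal (g z) ≤ ENNReal.ofReal (M * ak k ^ σ) := by
      calc ∫⁻ z in S ∩ T, ENNReal.ofReal (g z)
          ≤ ∫⁻ z in W ×ˢ ball (0 : EuclideanSpace ℝ (Fin 3)) (ak k), ENNReal.ofReal (g z) := lintegral_mono_set hsubT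
        _ = N k := lintegral_congr fun z => hptw z
        _ ≤ ENNReal.ofReal (M * ak k ^ σ) := hNle k hk
    have hNfin : ∫⁻ z in S ∩ T, ENNReal.ofReal (g z) < ⊤ := lt_of_le_of_lt hNT ENNReal.ofReal_lt_top
    have hum' : AEStronglyMeasurable (uncurry u) (volume.restrict S) :=
      hum.mono_measure (Measure.restrict_mono hSs le_rfl)
    have hpm' : AEStronglyMeasurable (uncurry p) (volume.restrict S) :=
      hpm.mono_measure (Measure.restrict_mono hSs le_rfl)
    have hgm : AEStronglyMeasurable g (volume.restrict S) := by
      have h1 : AEStronglyMeasurable (fun z : ℝ × EuclideanSpace ℝ (Fin 3) =>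
          ‖uncurry u z‖ ^ 3 + 2 * |uncurry p z| * ‖uncurry u z‖) (volume.restrict S) :=
        (hum'.norm.pow 3).add ((hpm'.norm.const_mul 2).mul hum'.norm)
      exact h1.congr (Eventually.of_forall fun z => by simp only [hg, uncurry])
    have hgint : IntegrableOn g (S ∩ T) volume := by
      refine ⟨hgm.mono_measure (Measure.restrict_mono inter_subset_left le_rfl), ?_⟩
      rw [hasFiniteIntegral_iff_enorm]
      refine lt_of_le_of_lt (lintegral_mono fun z => le_of_eq ?_) hNfin
      rw [Real.enorm_eq_ofReal (hg0 z)]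
    have hBint : IntegrableOn B S volume := by
      rw [hB, IntegrableOn, integrable_indicator_iff hTm]
      have h1 : IntegrableOn (fun z => C / Rk k * g z) (T ∩ S) volume := by
        rw [inter_comm]; exact hgint.const_mul (C / Rk k)
      simpa only [IntegrableOn, Measure.restrict_restrict hTm] using h1
    have hgradcont : Continuous (gradient (φ k)) := by
      have h1 : Continuous (fderiv ℝ (φ k)) := (hφ k).continuous_fderiv (by simp)
      exact (InnerProductSpace.toDual ℝ (EuclideanSpace ℝ (Fin 3))).symm.continuous.comp h1
    have hFmeas : AEStronglyMeasurable F (volume.restrict S) := by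
      have hgr : AEStronglyMeasurable (fun z : ℝ × EuclideanSpace ℝ (Fin 3) => gradient (φ k) z.2)
          (volume.restrict S) := (hgradcont.comp continuous_snd).aestronglyMeasurable
      have h1 : AEStronglyMeasurable (fun z : ℝ × EuclideanSpace ℝ (Fin 3) =>
          (‖uncurry u z‖ ^ 2 + 2 * uncurry p z) * ⟪uncurry u z, gradient (φ k) z.2⟫) (volume.restrict S) :=
        ((hum'.norm.pow 2).add (hpm'.const_mul 2)).mul (hum'.inner hgr)
      refine h1.congr (Eventually.of_forall fun z => ?_)
      simp only [hF, uncurry, zero_mul, mul_zero, zero_add]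
    have hFint : IntegrableOn F S volume :=
      hBint.mono' hFmeas (Eventually.of_forall fun z => by rw [Real.norm_eq_abs]; exact hFB z)
    calc ∫ z in S, F z ≤ ∫ z in S, B z := integral_mono hFint hBint fun z => (le_abs_self _).trans (hFB z)
      _ = C / Rk k * ∫ z in S ∩ T, g z := by
          rw [hB, setIntegral_indicator hTm, integral_const_mul]
      _ ≤ C / Rk k * (M * ak k ^ σ) := by
          refine mul_le_mul_of_nonneg_left ?_ (by positivity)
          have h1 : ∫ z in S ∩ T, g z = (∫⁻ z in S ∩ T, ENNReal.ofReal (g z)).toReal :=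
            integral_eq_lintegral_of_nonneg_ae (Eventually.of_forall hg0)
              (hgm.mono_measure (Measure.restrict_mono inter_subset_left le_rfl))
          rw [h1]
          have := ENNReal.toReal_mono ENNReal.ofReal_ne_top hNT
          rwa [ENNReal.toReal_ofReal (by positivity)] at this
  -- ## the energy bound at a.e. time: `e_k(t) ≤ e_k(s₀) + (C/R_k) M a_k^σ` for all `k ≥ k₀`
  refine ⟨C * M * (3 : ℝ) ^ σ, ?_⟩
  have h1 := ae_all_iff.2 hstart
  filter_upwards [h1, ae_restrict_mem measurableSet_Ioo] with t ht htW k hk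
  refine (ht k).trans (add_le_add le_rfl ((hfluxle k hk t htW.2.le).trans ?_))
  have hRk0' := hRk0 k
  have hak3 : ak k ^ σ ≤ (3 : ℝ) ^ σ * Rk k ^ σ := by
    rw [← Real.mul_rpow (by norm_num) hRk0'.le]
    exact Real.rpow_le_rpow (hak0 k).le (by simp only [hak]; linarith [hRk1 k]) hσ0
  have e1 : Rk k ^ σ / Rk k = Rk k ^ (s - 1 / 6) := by
    rw [div_eq_mul_inv, ← Real.rpow_neg_one, ← Real.rpow_add hRk0']
    congr 1; rw [hσ]; ring
  calc C / Rk k * (M * ak k ^ σ) ≤ C / Rk k * (M * ((3 : ℝ) ^ σ * Rk k ^ σ)) := by gcongr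
    _ = C * M * (3 : ℝ) ^ σ * (Rk k ^ σ / Rk k) := by ring
    _ = C * M * (3 : ℝ) ^ σ * ((k : ℝ) + 1) ^ ((1 - 2 * ρ) - 1 / 6) := by rw [e1]

end Summit.NavierStokesRegularity.NavierStokesRegularity.Theorems.PowerGaugeEulerLiouville

end
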